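import Summits.QuantumFields.QCD.Theses.NestedDissectionSea

/-!
# Sketch — crux-ideate stmt-QuantumFields-17812 (`RobustYangMillsRG`, rev 3), ideator 2, round 1

First-lemma signatures of the two idea cards (`af-funnel`, `curvature-ledger`).
Nothing here is proved; every `def` is a `Prop` over existing declarations.
-/

namespace Summit.QuantumFields.QCD.Cruxes.RobustYangMillsRG.Ideator2

open Filter Topology MeasureTheory
open Literature.MathematicalPhysics.QuantumLattice Literature.MathematicalPhysics.AQFT
  Literature.MathematicalPhysics.QuantumFieldTheory

/-- **C⁺ of card `af-funnel` (realisability-free transfer).**  Uniform time-slab clustering for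
EVERY probability-normalised signed Gibbs weight `exp(−βe·A − W)·F(LF V, V)·dHaar` on the block
torus `(ZMod M)^4`, `βe` in a compact window `[β₀, β₁]` above the threshold, `(A, W, F)` in the
coercive Bałaban format ball — no fine lattice, no weights `w`, no blocking map `Bl`.
Rate `Δ` in block units. -/
def FormatBallClustering : Prop :=
  let G := ↥(Matrix.specialUnitaryGroup (Fin 3) ℂ)
  let ρ : G →* Matrix (Fin 3) (Fin 3) ℂ := fundamentalRep (Fin 3)
  ∀ ε r B₀ κ c₀ cA A₀ : ℝ, 0 < ε → 0 < r → 0 < B₀ → 0 < κ → 0 < c₀ → 0 < cA → 0 < A₀ →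
  ∃ β₀ : ℝ, 0 < β₀ ∧ ∀ β₁ : ℝ, β₀ ≤ β₁ →
  ∃ Δ : ℝ, 0 < Δ ∧ ∀ h : ℕ, ∃ C : ℝ, ∀ (M : ℕ) [NeZero M],
  let μ : Measure (GaugeConfig 4 M G) := Measure.pi fun _ => haarProbability G
  let LF : GaugeConfig 4 M G → Finset (Site 4 M) := fun V =>
    Finset.univ.filter fun y => ∃ i j : Fin 4, ε < 3 - (ρ (plaquetteHolonomy V y i j)).trace.re
  ∀ (βe : ℝ) (A W : QuasiLocalGaugePerturbation 4 M G 1)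
    (F : Finset (Site 4 M) → GaugeConfig 4 M G → ℝ),
  β₀ ≤ βe → βe ≤ β₁ →
  A.HasAnalyticNormLE ρ (smallFieldDomain ρ 1 r ε) κ A₀ → A.NormLE κ A₀ →
  (∀ X ∈ polymers 1, (∃ V, A.act X V ≠ 0) →
    ∀ y ∈ X, ∀ y' ∈ X, ∀ i, (y i - y' i).val ≤ X.card ∨ (y' i - y i).val ≤ X.card) →
  (∀ V, cA * wilsonAction ρ V ≤ A.total V - A.total fun _ => 1) →
  W.HasAnalyticNormLE ρ (smallFieldDomain ρ 1 r ε) κ B₀ → W.NormLE κ B₀ →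
  (∀ X ∈ polymers 1, (∃ V, W.act X V ≠ 0) →
    ∀ y ∈ X, ∀ y' ∈ X, ∀ i, (y i - y' i).val ≤ X.card ∨ (y' i - y i).val ≤ X.card) →
  (∀ Z, Measurable (F Z)) → (∀ V, F ∅ V = 1) → (∀ Z V, |F Z V| ≤ Real.exp (c₀ * Z.card)) →
  (∀ Z (n : ℕ) V V', (∀ e, (∃ y ∈ Z, ∀ i, (e.1 i - y i).val ≤ n ∨ (y i - e.1 i).val ≤ n) →
      V e = V' e) → |F Z V - F Z V'| ≤ Real.exp (c₀ * Z.card + κ * (4 - n))) →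
  (∀ Z₁ Z₂ (n : ℕ), (∀ y ∈ Z₁, ∀ y' ∈ Z₂, ∃ i, n < (y i - y' i).val ∧ n < (y' i - y i).val) →
      ∀ V, |F (Z₁ ∪ Z₂) V - F Z₁ V * F Z₂ V| ≤ Real.exp (c₀ * (Z₁.card + Z₂.card) + κ * (4 - n))) →
  let dens : GaugeConfig 4 M G → ℝ := fun V =>
    Real.exp (-(βe * A.total V) - W.total V) * F (LF V) V
  let E : (GaugeConfig 4 M G → ℝ) → ℝ := fun G₀ => (∫ V, G₀ V * dens V ∂μ) / ∫ V, dens V ∂μ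
  (0 < ∫ V, dens V ∂μ) →
  ∀ (t : ℕ) (G₁ G₂ : GaugeConfig 4 M G → ℝ) (C₁ C₂ : ℝ), 2 * t ≤ M →
  Measurable G₁ → Measurable G₂ → (∀ V, |G₁ V| ≤ C₁) → (∀ V, |G₂ V| ≤ C₂) →
  DependsOn G₁ {e | (e.1 0).val < h} → DependsOn G₂ {e | (e.1 0).val < h} →
  |E (fun V => G₁ V * G₂ (torusConfigShift (Pi.single 0 (t : ZMod M)) V))
    - E G₁ * E (fun V => G₂ (torusConfigShift (Pi.single 0 (t : ZMod M)) V))|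
    ≤ C * C₁ * C₂ * Real.exp (-(Δ * t))

/-- **First lemma of card `af-funnel`**: the realisability-free format-ball statement implies the
crux verbatim (unpacking `AdmAt`: the block identity with `Gf := G` and `Gf := 1` turns every
`E k S (G ∘ Bl k S)` into the normalised `dens`-expectation on the block torus `M k S`;
eventually `β₀ ≤ βe k ≤ βl + 1 =: β₁`; `Δ_crux := Δ / ℓ₀`).  Size S–M, provable now. -/
def formatBall_transfer : Prop :=
  FormatBallClustering → Summit.QuantumFields.QCD.Theses.NestedDissectionSea.RobustYangMillsRG

/-- **Terminal certificate of card `curvature-ledger` (expansion form).**  Small quasi-local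
activity ⇒ volume-uniform time-slab clustering on the SU(3) block torus: the strong-coupling /
high-temperature end at which the multiscale Bakry–Émery ledger must arrive (there the group's
Ricci curvature dominates the Hessian of the flowed action; Osterwalder–Seiler 1978 cluster
expansion or Shen–Zhu–Zhu 2023 Bakry–Émery prove statements of exactly this type for the Wilson
action).  `η` = activity threshold, `Δ` in lattice units of the terminal scale. -/
def SmallActivityClustering : Prop :=
  let G := ↥(Matrix.specialUnitaryGroup (Fin 3) ℂ)
  ∀ κ : ℝ, 0 < κ → ∃ η : ℝ, 0 < η ∧ ∃ Δ : ℝ, 0 < Δ ∧ ∀ h : ℕ, ∃ C : ℝ, ∀ (M : ℕ) [NeZero M],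
  let μ : Measure (GaugeConfig 4 M G) := Measure.pi fun _ => haarProbability G
  ∀ (K : QuasiLocalGaugePerturbation 4 M G 1), K.NormLE κ η →
  (∀ X ∈ polymers 1, (∃ V, K.act X V ≠ 0) →
    ∀ y ∈ X, ∀ y' ∈ X, ∀ i, (y i - y' i).val ≤ X.card ∨ (y' i - y i).val ≤ X.card) →
  let dens : GaugeConfig 4 M G → ℝ := fun V => Real.exp (-(K.total V))
  let E : (GaugeConfig 4 M G → ℝ) → ℝ := fun G₀ => (∫ V, G₀ V * dens V ∂μ) / ∫ V, dens V ∂μ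
  (0 < ∫ V, dens V ∂μ) →
  ∀ (t : ℕ) (G₁ G₂ : GaugeConfig 4 M G → ℝ) (C₁ C₂ : ℝ), 2 * t ≤ M →
  Measurable G₁ → Measurable G₂ → (∀ V, |G₁ V| ≤ C₁) → (∀ V, |G₂ V| ≤ C₂) →
  DependsOn G₁ {e | (e.1 0).val < h} → DependsOn G₂ {e | (e.1 0).val < h} →
  |E (fun V => G₁ V * G₂ (torusConfigShift (Pi.single 0 (t : ZMod M)) V))
    - E G₁ * E (fun V => G₂ (torusConfigShift (Pi.single 0 (t : ZMod M)) V))|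
    ≤ C * C₁ * C₂ * Real.exp (-(Δ * t))

end Summit.QuantumFields.QCD.Cruxes.RobustYangMillsRG.Ideator2
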